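import Mathlib
import HarnessLib
import Summits.NavierStokesRegularity.NavierStokesRegularity.Theorems.PoloidalWindowDoorLrcModEntireGraphTransport
import Summits.NavierStokesRegularity.NavierStokesRegularity.Theorems.PoloidalWindowDoorLrcModEntireCurvedSheetUniqueness

/-!
# Route `PoloidalWindowDoor`, item `LrcModEntire` (stmt-NavierStokesRegularity-20428), cell (Q4-sonic, straight, μ < 0) `stub_Q4sonicLineNeg`, case I —
# THE SHEET-TANGENT KERNEL OF THE WEB HESSIAN ON A PARALLEL SONIC SHEET (data `∂_N g = 0` of T2B-g17 §5(5b))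

Cell ns-regularity-ideate, stub-worker seat ns-poloidal-K2-p2 g16 under the LEAD of item 20428 (ns-poloidal-K2-p3 g17);
`--supports stmt-NavierStokesRegularity-20428 --as helper`.  Memo `Cruxes/LrcModEntire/T2B-g17.md` v2 §5(5b): «`∂_N g = D²θ(W_τ)[e,N] = 0` because in case I
`∇θ∘W_τ = (0,0,B(τ))` is constant in `(s,z)` (sonic: `R(τ,·)` affine), so `D²θ(W_τ)` kills both sheet tangents `e`, `d_zJe + e₂` (rank one)».  Kernel form, class-free,
over `…GraphTransport.hessian_on_sonic_sheet` (p739456): on the graph sheet `W = s·e + G(s,z)·Je + z·e₂` with web criticality, constant vertical gradient and the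
slice law, once the webs are PARALLEL (`∂_sG = 0`, B-T `…SonicWebsParallel`):

* `hessian_e2_e_on_sonic_sheet` — the sixth entry `D²θ(W)[e₂, e] = G_sG_z·A` (completes the rank-one table of `hessian_on_sonic_sheet`);
* ★ `hessian_kernel_of_parallel` — `D²θ(W)[e, v] = 0`, `D²θ(W)[v, e] = 0` and `D²θ(W)[G_z•Je + e₂, v] = 0` for EVERY `v`: both sheet tangents are in the kernel.

WHAT THIS IS NOT: not a claim about Navier–Stokes regularity; one datum of LEAD's (CK2) Cauchy problem in kernel form; items 20428 / 19708 / 27893 OPEN.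
-/

noncomputable section

-- the summit and its single sub-problem share the name (CONVENTIONS §1), as in every Theorems file
set_option linter.dupNamespace false

namespace Summit.NavierStokesRegularity.NavierStokesRegularity.Theorems.PoloidalWindowDoorLrcModEntireSonicSheetKernel

open Set Function Filter Topology
open scoped InnerProductSpace RealInnerProductSpace ContDiff
open Summit.NavierStokesRegularity.NavierStokesRegularity.Theorems.PoloidalWindowDoorLrcModEntireSheetFlattenTools
open Summit.NavierStokesRegularity.NavierStokesRegularity.Theorems.PoloidalWindowDoorLrcModEntireParallelWebsIdentity
open Summit.NavierStokesRegularity.NavierStokesRegularity.Theorems.PoloidalWindowDoorLrcModEntireRidgeGlobalBranchFrame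
open Summit.NavierStokesRegularity.NavierStokesRegularity.Theorems.PoloidalWindowDoorLrcModEntireCurvedWebHuygens
open Summit.NavierStokesRegularity.NavierStokesRegularity.Theorems.PoloidalWindowDoorLrcModEntireCurvedSheetUniqueness
open Summit.NavierStokesRegularity.NavierStokesRegularity.Theorems.PoloidalWindowDoorLrcModEntireGraphTransport

variable {θ : EuclideanSpace ℝ (Fin 3) → ℝ} {e : EuclideanSpace ℝ (Fin 3)} {I : Set ℝ} {μ : ℝ → ℝ} {G : ℝ × ℝ → ℝ} {β : ℝ}

/-- The sixth Hessian entry on a sonic sheet: `D²θ(W)[e₂, e] = G_s·G_z·A`. -/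
theorem hessian_e2_e_on_sonic_sheet (hθ : ContDiff ℝ 3 θ) (he2 : e 2 = 0) (hI : IsOpen I) (hG : ContDiffOn ℝ 2 G (region I))
    (hlaw : ∀ x : EuclideanSpace ℝ (Fin 3), x 2 ∈ I →
      fderiv ℝ (fderiv ℝ θ) x e2 e2 = -μ (x 2) * (fderiv ℝ (fderiv ℝ θ) x e e + fderiv ℝ (fderiv ℝ θ) x (Jvec e) (Jvec e)))
    (hce : ∀ p ∈ region I, fderiv ℝ θ (webMap e G p) e = 0)
    (hcJ : ∀ p ∈ region I, fderiv ℝ θ (webMap e G p) (Jvec e) = 0)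
    (hc2 : ∀ p ∈ region I, fderiv ℝ θ (webMap e G p) e2 = β)
    (hA : ∀ p ∈ region I, fderiv ℝ (fderiv ℝ θ) (webMap e G p) (Jvec e) (Jvec e) ≠ 0) :
    ∀ p ∈ region I, fderiv ℝ (fderiv ℝ θ) (webMap e G p) e2 e =
      fderiv ℝ G p (1, 0) * fderiv ℝ G p (0, 1) * fderiv ℝ (fderiv ℝ θ) (webMap e G p) (Jvec e) (Jvec e) := by
  intro p hp
  have hθ2 : ContDiff ℝ 2 θ := hθ.of_le (by norm_cast)
  have hGd : DifferentiableAt ℝ G p := (hG.contDiffAt ((isOpen_region hI).mem_nhds hp)).differentiableAt (by norm_num)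
  have hsym : ∀ u v, fderiv ℝ (fderiv ℝ θ) (webMap e G p) u v = fderiv ℝ (fderiv ℝ θ) (webMap e G p) v u := fun u v =>
    (hθ2.contDiffAt.isSymmSndFDerivAt (by simp)) u v
  obtain ⟨c1, -, -, -, -⟩ := hessian_on_sonic_sheet hθ he2 hI hG hlaw hce hcJ hc2 hA p hp
  -- `∂_z` of `∂_eθ(W) ≡ 0`
  have h := fderiv_eq_zero_of_eqOn_region hI hce hp (0, 1)
  rw [fderiv_grad_comp hθ2 hGd] at h
  simp only [one_smul, zero_smul, zero_add, map_add, map_smul, _root_.add_apply, _root_.smul_apply, smul_eq_mul] at h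
  rw [hsym (Jvec e) e, c1] at h
  linear_combination h

/-- ★ **On a PARALLEL sonic sheet both sheet tangents `e` and `G_z•Je + e₂` are in the kernel of the web Hessian.** -/
theorem hessian_kernel_of_parallel (hθ : ContDiff ℝ 3 θ) (he2 : e 2 = 0) (hun : ‖e‖ = 1) (hI : IsOpen I) (hG : ContDiffOn ℝ 2 G (region I))
    (hlaw : ∀ x : EuclideanSpace ℝ (Fin 3), x 2 ∈ I →
      fderiv ℝ (fderiv ℝ θ) x e2 e2 = -μ (x 2) * (fderiv ℝ (fderiv ℝ θ) x e e + fderiv ℝ (fderiv ℝ θ) x (Jvec e) (Jvec e)))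
    (hce : ∀ p ∈ region I, fderiv ℝ θ (webMap e G p) e = 0)
    (hcJ : ∀ p ∈ region I, fderiv ℝ θ (webMap e G p) (Jvec e) = 0)
    (hc2 : ∀ p ∈ region I, fderiv ℝ θ (webMap e G p) e2 = β)
    (hA : ∀ p ∈ region I, fderiv ℝ (fderiv ℝ θ) (webMap e G p) (Jvec e) (Jvec e) ≠ 0)
    (hpar : ∀ p ∈ region I, fderiv ℝ G p (1, 0) = 0) :
    ∀ p ∈ region I,
      (∀ v, fderiv ℝ (fderiv ℝ θ) (webMap e G p) e v = 0) ∧ (∀ v, fderiv ℝ (fderiv ℝ θ) (webMap e G p) v e = 0) ∧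
      (∀ v, fderiv ℝ (fderiv ℝ θ) (webMap e G p) (fderiv ℝ G p (0, 1) • Jvec e + e2) v = 0) := by
  intro p hp
  have hθ2 : ContDiff ℝ 2 θ := hθ.of_le (by norm_cast)
  have hsym : ∀ u v, fderiv ℝ (fderiv ℝ θ) (webMap e G p) u v = fderiv ℝ (fderiv ℝ θ) (webMap e G p) v u := fun u v =>
    (hθ2.contDiffAt.isSymmSndFDerivAt (by simp)) u v
  obtain ⟨c1, c2, c3, c5, -⟩ := hessian_on_sonic_sheet hθ he2 hI hG hlaw hce hcJ hc2 hA p hp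
  have c4 := hessian_e2_e_on_sonic_sheet hθ he2 hI hG hlaw hce hcJ hc2 hA p hp
  have hPs := hpar p hp
  set H := fderiv ℝ (fderiv ℝ θ) (webMap e G p) with hH
  set A := H (Jvec e) (Jvec e) with hAdef
  set Pz := fderiv ℝ G p (0, 1) with hPz
  rw [hPs] at c1 c3 c4
  -- the six entries, with `∂_sG = 0`
  have k1 : H e e = 0 := by rw [c3]; ring
  have k2 : H e (Jvec e) = 0 := by rw [c1]; ring
  have k3 : H e e2 = 0 := by rw [hsym, c4]; ring
  have k4 : H (Jvec e) e2 = -Pz * A := by rw [hsym, c2]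
  -- frame expansion of an arbitrary vector
  have hdec : ∀ v : EuclideanSpace ℝ (Fin 3), v = ⟪v, e⟫ • e + (v 2) • e2 + ⟪v, Jvec e⟫ • Jvec e := by
    intro v
    have h := decomp_frame he2 hun 0 v
    simp only [zero_smul, zero_add, zero_mul, sub_zero, ← Jvec_eq_rotJ] at h
    exact h
  have hrow : ∀ v, H e v = 0 := by
    intro v
    rw [hdec v]
    simp only [map_add, map_smul, smul_eq_mul, k1, k2, k3, mul_zero, add_zero]
  refine ⟨hrow, fun v => by rw [hsym]; exact hrow v, fun v => ?_⟩
  rw [hdec v]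
  simp only [map_add, map_smul, _root_.add_apply, _root_.smul_apply, smul_eq_mul]
  rw [hsym (Jvec e) e, hsym e2 e, k2, k3, k4, c2, c5, ← hAdef]
  ring

end Summit.NavierStokesRegularity.NavierStokesRegularity.Theorems.PoloidalWindowDoorLrcModEntireSonicSheetKernel

end
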